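import Literature.Analysis.FluidPDE.PressureDecayEstimate
import Literature.Analysis.FluidPDE.SereginSverakPressureDecay
import Literature.Analysis.FluidPDE.SereginSverakPressureDecayBalls
import Literature.Analysis.FluidPDE.HessianLaplacianLpProofs
import HarnessLib

/-!
# The decay estimate for the pressure, ball form (Seregin–Šverák 2009, (as13)): discharge of
`seregin_sverak_pressure_decay`

Analysis/FluidPDE proof file (no new definitions, no new named facts); sibling of
`PressureDecayEstimate.lean`, whose named fact
`Literature.Analysis.FluidPDE.seregin_sverak_pressure_decay` — G. Seregin, V. Šverák, *On Type I
singularities of the local axi-symmetric solutions of the Navier–Stokes equations*, Comm. PDE 34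
(2009) 171–201 = arXiv:0804.1803, proof of Lemma 3.5, display (as13) (arXiv p. 10): "and the decay
estimate for the pressure field `D(z_b, ϱ; q) ≤ c [ (ϱ/r) D(z_b, r; q) + (r/ϱ)² C(z_b, r; v) ]`.
Here, `z_b` and `r` satisfy conditions (as5) and `0 < ϱ ≤ r`", read with balls as space sections
(`D = cknD`, `C = cknC` over the backward cylinders `Q_r(z) = ]t - r², t[ × B_r(x)`), for every
distributional solution of the unforced unit-viscosity Navier–Stokes equations on an open
`Q ⊇ Q_r(z)` — is PROVED here:

* `seregin_sverak_pressure_decay_holds : seregin_sverak_pressure_decay`.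

## The argument

Everything analytic is already in the tree, on the coordinate cylinders
`Q(z, R) = ]t - R², t[ × 𝒞(x, R)`, `𝒞(x, R) = {|y' - x'| < R, |y₃ - x₃| < R}` of Seregin–Šverák
(§3, arXiv p. 9):

* `SereginSverak2009.exists_setLIntegral_pressure_rpow_parCyl_le` (`SereginSverakPressureDecay.lean`,
  proved there from the pressure equation in `𝒟'`, the split `p = p₁ + p₂` into the
  Calderón–Zygmund part and a harmonic remainder, the interior estimate for harmonic functions,
  a mollifier sequence and Fatou): an absolute `K < ∞` with
  `∫∫_{Q(z,ϱ)} |p|^{3/2} ≤ K [ (ϱ/R)³ ∫∫_{Q(z,R)} |p|^{3/2} + C^{3/2} ∫∫_{Q(z,R)} |u|³ ]` for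
  `0 < ϱ ≤ R/4`, every distributional solution on `Q(z, R)` with `u ∈ L³`, `p ∈ L^{3/2}` there,
  `C` being a scale-uniform `L^{3/2}` bound for the Hessian of the truncated Newtonian potential;
* that Calderón–Zygmund bound, from Stein's Proposition 3 now proved on `ℝ³`
  (`stein1970_hessian_Lp_bound_holds_fin3`, `HessianLaplacianLpProofs.lean`, through
  `stein1970_hessian_Lp_bound.hessian_newtonNearPotential_half`);
* the comparison of balls and coordinate cylinders (`SereginSverakPressureDecayBalls.lean`):
  `Q_R(z) ⊆ Q(z, R)` (`parabolicCylinder_subset_parCyl`) and `Q(z, R) ⊆ Q_{√2 R}(z)`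
  (`parCyl_subset_parabolicCylinder`), whence `Q(z, r/2) ⊆ Q_r(z)`
  (`SereginSverak2009.parCyl_half_subset_parabolicCylinder` below).

Given `Q_r(z) ⊆ Q` and `0 < ϱ ≤ r`: if `D(r; z) = ∞` or `C(r; z) = ∞` the right-hand side is `∞`.
Otherwise `(u, p)` restricts to a distributional solution on `Q(z, r/2) ⊆ Q_r(z) ⊆ Q` with
`u ∈ L³`, `p ∈ L^{3/2}` there. For `ϱ ≤ r/8 = (r/2)/4`,
`ϱ² D(ϱ; z) = ∫∫_{Q_ϱ(z)} |p|^{3/2} ≤ ∫∫_{Q(z,ϱ)} |p|^{3/2}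
  ≤ K [ (2ϱ/r)³ ∫∫_{Q(z,r/2)} |p|^{3/2} + C^{3/2} ∫∫_{Q(z,r/2)} |u|³ ]
  ≤ K [ (2ϱ/r)³ r² D(r; z) + C^{3/2} r² C(r; z) ]`,
i.e. `D(ϱ; z) ≤ 8K (ϱ/r) D(r; z) + K C^{3/2} (r/ϱ)² C(r; z)`; for `r/8 < ϱ ≤ r` trivially
`D(ϱ; z) ≤ (r/ϱ)² D(r; z) ≤ 512 (ϱ/r) D(r; z)`. Both are `≤ c [(ϱ/r) D(r; z) + (r/ϱ)² C(r; z)]`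
with `c = max (8K max(1, C^{3/2}), 512)`.

This is the printed mechanism (Seregin, J. Math. Fluid Mech. 9 (2007) = arXiv:math/0510396, §2
(p9)–(p12); Seregin, *Lecture notes* (2014), proof of Lemma 6.4) — see the module docstring of
`PressureDecayEstimate.lean`; the present file only moves it from Seregin–Šverák's cylinders `𝒞`
("just for convenience, we replace balls with cylinders", Seregin 2014 §6.5) back to balls.

## References

* G. Seregin, V. Šverák, Comm. PDE 34 (2009) 171–201 = arXiv:0804.1803, §3 p. 9 (cylinders `𝒞`,
  `Q(z₀, R)`, the functionals `C`, `D`), proof of Lemma 3.5, (as13) (p. 10). [`SereginSverak2009`]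
* G. Seregin, J. Math. Fluid Mech. 9 (2007) 34–43 = arXiv:math/0510396, §2 (p9)–(p12). [`Seregin2005`]
* G. Seregin, *Lecture notes on regularity theory for the Navier–Stokes equations*, World
  Scientific (2014), Lemma 6.4, §6.5. [`Seregin2014`]
* E. M. Stein, *Singular integrals and differentiability properties of functions* (1970), Ch. III
  §1.3 Prop. 3. [`Stein1971`]
-/

noncomputable section

open MeasureTheory Set Function Filter Topology TopologicalSpace Metric
open scoped NNReal ENNReal

namespace Literature.Analysis.FluidPDE

/-! ### Geometry and arithmetic of the comparison -/

/-- `Q(z, r/2) ⊆ Q_r(z)` for `r ≥ 0`: Seregin–Šverák's coordinate cylinder of radius `r/2` lies in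
the ball cylinder of radius `r` about the same centre (`Q(z, r/2) ⊆ Q_{√2 r/2}(z) ⊆ Q_r(z)`).
[folklore] -/
theorem SereginSverak2009.parCyl_half_subset_parabolicCylinder (z : ℝ × EuclideanSpace ℝ (Fin 3)) {r : ℝ} (hr : 0 ≤ r) :
    SereginSverak2009.parCyl z (r / 2) ⊆ parabolicCylinder r z := by
  intro w hw
  have hw' := parCyl_subset_parabolicCylinder z (by positivity : (0 : ℝ) ≤ r / 2) hw
  rw [mem_parabolicCylinder] at hw' ⊢
  obtain ⟨⟨h1, h2⟩, h3⟩ := hw'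
  have hs2 : Real.sqrt 2 ≤ 2 := by
    rw [Real.sqrt_le_left (by norm_num)]
    norm_num
  have hs : Real.sqrt 2 * (r / 2) ≤ r := by nlinarith
  have hsq : (Real.sqrt 2 * (r / 2)) ^ 2 ≤ r ^ 2 := pow_le_pow_left₀ (by positivity) hs 2
  exact ⟨⟨by linarith, h2⟩, h3.trans_le hs⟩

/-- The scaling identity `ϱ⁻² (ϱ/(r/2))³ r² = 8 ϱ/r` in `ℝ≥0∞` (`r, ϱ > 0`). [folklore] -/
theorem SereginSverak2009.inv_sq_mul_ofReal_cube_half_mul_sq {r ϱ : ℝ} (hr : 0 < r) (hϱ : 0 < ϱ) :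
    (ENNReal.ofReal ϱ ^ 2)⁻¹ * ENNReal.ofReal ((ϱ / (r / 2)) ^ 3) * ENNReal.ofReal r ^ 2 =
      8 * ENNReal.ofReal (ϱ / r) := by
  rw [← ENNReal.ofReal_pow hϱ.le, ← ENNReal.ofReal_pow hr.le, ← ENNReal.ofReal_inv_of_pos (by positivity),
    ← ENNReal.ofReal_mul (by positivity), ← ENNReal.ofReal_mul (by positivity),
    ← ENNReal.ofReal_ofNat 8, ← ENNReal.ofReal_mul (by norm_num)]
  congr 1
  field_simp
  ring

/-- The elementary inequality of the trivial range: for `r/8 < ϱ ≤ r` (`r, ϱ > 0`),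
`(r/ϱ)² ≤ 512 (ϱ/r)` in `ℝ≥0∞`. [folklore] -/
theorem SereginSverak2009.ofReal_sq_ratio_le_of_lt_eighth {r ϱ : ℝ} (hr : 0 < r) (hϱ : 0 < ϱ)
    (h : r / 8 < ϱ) : ENNReal.ofReal ((r / ϱ) ^ 2) ≤ 512 * ENNReal.ofReal (ϱ / r) := by
  rw [← ENNReal.ofReal_ofNat 512, ← ENNReal.ofReal_mul (by norm_num)]
  refine ENNReal.ofReal_le_ofReal ?_
  have h1 : r / ϱ < 8 := by rw [div_lt_iff₀ hϱ]; linarith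
  have h2 : 1 / 8 < ϱ / r := by rw [lt_div_iff₀ hr]; linarith
  have h3 : 0 < r / ϱ := by positivity
  nlinarith

/-! ### The discharge -/

/-- **Seregin–Šverák 2009, (as13), ball form — PROVED.** There is a universal constant `c` such
that for every distributional solution `(u, p)` of the unforced unit-viscosity Navier–Stokes
equations on an open `Q ⊆ ℝ × ℝ³`, every backward cylinder `Q_r(z) ⊆ Q` and every `0 < ϱ ≤ r`,
`D(ϱ; z) ≤ c ((ϱ/r) D(r; z) + (r/ϱ)² C(r; z))` (`D = cknD`, `C = cknC`). Proof: the local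
`L^{3/2}` pressure estimate on Seregin–Šverák's coordinate cylinders
(`SereginSverak2009.exists_setLIntegral_pressure_rpow_parCyl_le`, fed with the Calderón–Zygmund
constant of `stein1970_hessian_Lp_bound_holds_fin3.hessian_newtonNearPotential_half` at exponent
`3/2`) applied on `Q(z, r/2) ⊆ Q_r(z) ⊆ Q` for `ϱ ≤ r/8`, the monotonicity
`D(ϱ) ≤ (r/ϱ)² D(r) ≤ 512 (ϱ/r) D(r)` for `r/8 < ϱ ≤ r`, and `∞` on the right when `D(r; z)` or
`C(r; z)` is infinite (module docstring). [cite: SereginSverak2009, proof of Lemma 3.5, (as13) (arXiv:0804.1803 p. 10), ball form] -/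
theorem seregin_sverak_pressure_decay_holds : seregin_sverak_pressure_decay := by
  -- Step 0: the Calderón–Zygmund constant at exponent `3/2` and the constant of the local estimate
  have h132 : (1 : ℝ≥0∞) < 3 / 2 := by
    rw [ENNReal.lt_div_iff_mul_lt (Or.inl (by norm_num)) (Or.inl (by norm_num)), one_mul]
    exact_mod_cast (by norm_num : (2 : ℕ) < 3)
  have h32top : (3 / 2 : ℝ≥0∞) < ⊤ := ENNReal.div_lt_top (by norm_num) (by norm_num)
  obtain ⟨C, hC⟩ := stein1970_hessian_Lp_bound_holds_fin3.hessian_newtonNearPotential_half h132 h32top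
  obtain ⟨K, hKtop, hK⟩ := SereginSverak2009.exists_setLIntegral_pressure_rpow_parCyl_le
  -- the constant
  set cE : ℝ≥0∞ := max (8 * K * max 1 ((C : ℝ≥0∞) ^ (3 / 2 : ℝ))) 512 with hcE
  have hCtop : (C : ℝ≥0∞) ^ (3 / 2 : ℝ) ≠ ⊤ :=
    ENNReal.rpow_ne_top_of_nonneg (by norm_num) ENNReal.coe_ne_top
  have hcEtop : cE ≠ ⊤ :=
    (max_lt (lt_top_iff_ne_top.2 (ENNReal.mul_ne_top (ENNReal.mul_ne_top (by norm_num) hKtop)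
      (max_lt ENNReal.one_lt_top (lt_top_iff_ne_top.2 hCtop)).ne))
      (by simp : (512 : ℝ≥0∞) < ⊤)).ne
  have h512 : (512 : ℝ≥0∞) ≤ cE := le_max_right _ _
  have hcE0 : cE ≠ 0 := (lt_of_lt_of_le (by norm_num : (0 : ℝ≥0∞) < 512) h512).ne'
  have h8K : 8 * K ≤ cE :=
    calc 8 * K = 8 * K * 1 := (mul_one _).symm
      _ ≤ 8 * K * max 1 ((C : ℝ≥0∞) ^ (3 / 2 : ℝ)) := mul_le_mul' le_rfl (le_max_left _ _)
      _ ≤ cE := le_max_left _ _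
  have hKC : K * (C : ℝ≥0∞) ^ (3 / 2 : ℝ) ≤ cE :=
    calc K * (C : ℝ≥0∞) ^ (3 / 2 : ℝ) = 1 * K * (C : ℝ≥0∞) ^ (3 / 2 : ℝ) := by rw [one_mul]
      _ ≤ 8 * K * max 1 ((C : ℝ≥0∞) ^ (3 / 2 : ℝ)) :=
          mul_le_mul' (mul_le_mul' (by norm_num) le_rfl) (le_max_right _ _)
      _ ≤ cE := le_max_left _ _
  refine ⟨cE.toNNReal, ?_⟩
  rintro Q u p hsol ⟨t₀, x₀⟩ r ϱ hϱ hϱr hsub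
  rw [ENNReal.coe_toNNReal hcEtop]
  have hr : 0 < r := hϱ.trans_le hϱr
  have hr0 : ENNReal.ofReal r ^ 2 ≠ 0 := pow_ne_zero _ (ENNReal.ofReal_pos.2 hr).ne'
  have hrt : ENNReal.ofReal r ^ 2 ≠ ⊤ := ENNReal.pow_ne_top ENNReal.ofReal_ne_top
  have hϱr0 : ENNReal.ofReal (ϱ / r) ≠ 0 := (ENNReal.ofReal_pos.2 (div_pos hϱ hr)).ne'
  have hrϱ0 : ENNReal.ofReal ((r / ϱ) ^ 2) ≠ 0 := (ENNReal.ofReal_pos.2 (by positivity)).ne'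
  -- un-normalising the functionals on `Q_r(z)`
  have hIP : ∫⁻ w in parabolicCylinder r (t₀, x₀), ‖p w.1 w.2‖ₑ ^ (3 / 2 : ℝ) =
      ENNReal.ofReal r ^ 2 * cknD r (t₀, x₀) p := by
    rw [cknD, ← mul_assoc, ENNReal.mul_inv_cancel hr0 hrt, one_mul]
  have hIU : ∫⁻ w in parabolicCylinder r (t₀, x₀), ‖u w.1 w.2‖ₑ ^ (3 : ℕ) =
      ENNReal.ofReal r ^ 2 * cknC r (t₀, x₀) u := by
    rw [cknC, ← mul_assoc, ENNReal.mul_inv_cancel hr0 hrt, one_mul]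
  -- Step 1: the degenerate cases `D(r; z) = ∞`, `C(r; z) = ∞`
  by_cases hDtop : cknD r (t₀, x₀) p = ⊤
  · rw [hDtop, ENNReal.mul_top hϱr0, top_add, ENNReal.mul_top hcE0]
    exact le_top
  by_cases hCtop' : cknC r (t₀, x₀) u = ⊤
  · rw [hCtop', ENNReal.mul_top hrϱ0, add_top, ENNReal.mul_top hcE0]
    exact le_top
  -- Step 2: restriction to the coordinate cylinder `Q(z, r/2) ⊆ Q_r(z) ⊆ Q`
  have hhalf : SereginSverak2009.parCyl (t₀, x₀) (r / 2) ⊆ parabolicCylinder r (t₀, x₀) :=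
    SereginSverak2009.parCyl_half_subset_parabolicCylinder _ hr.le
  have hle : SereginSverak2009.parCylOpens (t₀, x₀) (r / 2) ≤ Q := fun w hw => hsub (hhalf hw)
  have hsol' : IsDistributionalNSSolutionOn (SereginSverak2009.parCylOpens (t₀, x₀) (r / 2)) 1 0 u p :=
    hsol.of_le hle
  have hu3 : ∫⁻ w in SereginSverak2009.parCyl (t₀, x₀) (r / 2), ‖u w.1 w.2‖ₑ ^ (3 : ℕ) < ⊤ := by
    refine lt_of_le_of_lt (lintegral_mono_set hhalf) ?_
    rw [hIU]
    exact ENNReal.mul_lt_top hrt.lt_top (lt_top_iff_ne_top.2 hCtop')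
  have hp32 : ∫⁻ w in SereginSverak2009.parCyl (t₀, x₀) (r / 2), ‖p w.1 w.2‖ₑ ^ (3 / 2 : ℝ) < ⊤ := by
    refine lt_of_le_of_lt (lintegral_mono_set hhalf) ?_
    rw [hIP]
    exact ENNReal.mul_lt_top hrt.lt_top (lt_top_iff_ne_top.2 hDtop)
  -- Step 3: the two ranges of `ϱ`
  rcases le_or_gt ϱ (r / 8) with hcase | hcase
  · -- main case `ϱ ≤ r/8 = (r/2)/4`: the local estimate between `Q(z, ϱ)` and `Q(z, r/2)`
    have hmain := hK C hC u p 1 t₀ x₀ (r / 2) ϱ (half_pos hr) hϱ (by linarith) hsol' hu3 hp32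
    calc cknD ϱ (t₀, x₀) p
        = (ENNReal.ofReal ϱ ^ 2)⁻¹ *
            ∫⁻ w in parabolicCylinder ϱ (t₀, x₀), ‖p w.1 w.2‖ₑ ^ (3 / 2 : ℝ) := rfl
      _ ≤ (ENNReal.ofReal ϱ ^ 2)⁻¹ *
            ∫⁻ w in SereginSverak2009.parCyl (t₀, x₀) ϱ, ‖p w.1 w.2‖ₑ ^ (3 / 2 : ℝ) :=
          mul_le_mul' le_rfl (lintegral_mono_set (parabolicCylinder_subset_parCyl _ _))
      _ ≤ (ENNReal.ofReal ϱ ^ 2)⁻¹ * (K * (ENNReal.ofReal ((ϱ / (r / 2)) ^ 3) *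
            (∫⁻ w in SereginSverak2009.parCyl (t₀, x₀) (r / 2), ‖p w.1 w.2‖ₑ ^ (3 / 2 : ℝ)) +
            (C : ℝ≥0∞) ^ (3 / 2 : ℝ) *
              (∫⁻ w in SereginSverak2009.parCyl (t₀, x₀) (r / 2), ‖u w.1 w.2‖ₑ ^ (3 : ℕ)))) :=
          mul_le_mul' le_rfl hmain
      _ ≤ (ENNReal.ofReal ϱ ^ 2)⁻¹ * (K * (ENNReal.ofReal ((ϱ / (r / 2)) ^ 3) *
            (∫⁻ w in parabolicCylinder r (t₀, x₀), ‖p w.1 w.2‖ₑ ^ (3 / 2 : ℝ)) +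
            (C : ℝ≥0∞) ^ (3 / 2 : ℝ) *
              (∫⁻ w in parabolicCylinder r (t₀, x₀), ‖u w.1 w.2‖ₑ ^ (3 : ℕ)))) :=
          mul_le_mul' le_rfl (mul_le_mul' le_rfl (add_le_add
            (mul_le_mul' le_rfl (lintegral_mono_set hhalf))
            (mul_le_mul' le_rfl (lintegral_mono_set hhalf))))
      _ = K * ((ENNReal.ofReal ϱ ^ 2)⁻¹ * ENNReal.ofReal ((ϱ / (r / 2)) ^ 3) * ENNReal.ofReal r ^ 2) *
            cknD r (t₀, x₀) p +
          K * (C : ℝ≥0∞) ^ (3 / 2 : ℝ) * ((ENNReal.ofReal ϱ ^ 2)⁻¹ * ENNReal.ofReal r ^ 2) *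
            cknC r (t₀, x₀) u := by
          rw [hIP, hIU]
          ring
      _ = 8 * K * (ENNReal.ofReal (ϱ / r) * cknD r (t₀, x₀) p) +
          K * (C : ℝ≥0∞) ^ (3 / 2 : ℝ) * (ENNReal.ofReal ((r / ϱ) ^ 2) * cknC r (t₀, x₀) u) := by
          rw [SereginSverak2009.inv_sq_mul_ofReal_cube_half_mul_sq hr hϱ,
            SereginSverak2009.inv_sq_mul_sq hr hϱ]
          ring
      _ ≤ cE * (ENNReal.ofReal (ϱ / r) * cknD r (t₀, x₀) p) +
          cE * (ENNReal.ofReal ((r / ϱ) ^ 2) * cknC r (t₀, x₀) u) :=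
          add_le_add (mul_le_mul' h8K le_rfl) (mul_le_mul' hKC le_rfl)
      _ = cE * (ENNReal.ofReal (ϱ / r) * cknD r (t₀, x₀) p +
          ENNReal.ofReal ((r / ϱ) ^ 2) * cknC r (t₀, x₀) u) := by
          rw [mul_add]
  · -- trivial range `r/8 < ϱ ≤ r`: `D(ϱ; z) ≤ (r/ϱ)² D(r; z) ≤ 512 (ϱ/r) D(r; z)`
    have hmono : parabolicCylinder ϱ (t₀, x₀) ⊆ parabolicCylinder r (t₀, x₀) := by
      have h2 : ϱ ^ 2 ≤ r ^ 2 := pow_le_pow_left₀ hϱ.le hϱr 2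
      exact prod_mono (Ioo_subset_Ioo (by linarith) le_rfl) (ball_subset_ball hϱr)
    calc cknD ϱ (t₀, x₀) p
        = (ENNReal.ofReal ϱ ^ 2)⁻¹ *
            ∫⁻ w in parabolicCylinder ϱ (t₀, x₀), ‖p w.1 w.2‖ₑ ^ (3 / 2 : ℝ) := rfl
      _ ≤ (ENNReal.ofReal ϱ ^ 2)⁻¹ *
            ∫⁻ w in parabolicCylinder r (t₀, x₀), ‖p w.1 w.2‖ₑ ^ (3 / 2 : ℝ) :=
          mul_le_mul' le_rfl (lintegral_mono_set hmono)
      _ = ENNReal.ofReal ((r / ϱ) ^ 2) * cknD r (t₀, x₀) p := by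
          rw [hIP, ← mul_assoc, SereginSverak2009.inv_sq_mul_sq hr hϱ]
      _ ≤ 512 * ENNReal.ofReal (ϱ / r) * cknD r (t₀, x₀) p :=
          mul_le_mul' (SereginSverak2009.ofReal_sq_ratio_le_of_lt_eighth hr hϱ hcase) le_rfl
      _ ≤ cE * (ENNReal.ofReal (ϱ / r) * cknD r (t₀, x₀) p) := by
          rw [mul_assoc]
          exact mul_le_mul' h512 le_rfl
      _ ≤ cE * (ENNReal.ofReal (ϱ / r) * cknD r (t₀, x₀) p +
          ENNReal.ofReal ((r / ϱ) ^ 2) * cknC r (t₀, x₀) u) :=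
          mul_le_mul' le_rfl le_self_add

end Literature.Analysis.FluidPDE

end
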